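import Summits.QuantumFields.QCD.Theorems.NestedDissectionSeaCoerciveSeaSchurSeparator

/-!
# Crux `CoerciveSea` (stmt-QuantumFields-13901) — the separator event in PROPAGATOR form
# (`HasSingularSeparator U μ s τ ↔ ‖(D_c(μ)⁻¹)_ΣΣ‖ > 1/τ` for an invertible cell; exact linear algebra)

Helper file of line lead c4, line `chirality-collapses-pseudospectrum`, usable by every line of the crux, by the glue item
`CoerciveOfDilute` (stmt-QuantumFields-14759) and by the bridge. Clause (i) of the crux is stated in HARMONIC-EXTENSION form
(`HasSingularSeparator U μ s τ`: a vector on the box, harmonic on the sixteen children interiors, non-zero on the internal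
separator `Σ`, separator residual `< τ ×` its separator mass). Lead c1 identified it with the near-kernel of the SCHUR
SEPARATOR MATRIX (`hasSingularSeparator_iff_schur`, under invertibility of the children block). This file gives the third,
hypothesis-light form: whenever the CELL ITSELF is invertible (`IsUnit (wilsonCell U μ 0 s).det` — off the cell's own
crossing masses, a finite set of bare masses for each field), the event is EXACTLY

  `∃ v ≠ 0 on Σ, ‖v‖² < τ² ‖(D_c⁻¹)_ΣΣ v‖²`, i.e. `‖1_Σ D_c(μ)⁻¹ 1_Σ‖ > 1/τ`,

a LARGE VALUE of the cell propagator (Green's function) compressed to the internal separator — no children block, no Schur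
complement. (→: the separator part `v` of the residual `D_c w` reproduces `w|_Σ = (D_c⁻¹)_ΣΣ v` because the residual
vanishes inside; ←: `w = D_c⁻¹ (v` extended by `0)` is harmonic inside with residual `v`.) Consequently (no hypothesis)
`HasSingularSeparator U μ s τ → det D_c(μ) = 0 ∨ ‖(D_c⁻¹)_ΣΣ‖ > 1/τ` (`hasSingularSeparator_imp`), which is the form in
which clause (i) is a WEGNER-TYPE (weak-`L¹`) ESTIMATE for the surface-compressed Green's function of a near-critical
Dirichlet Wilson–Dirac cell — the object that multiscale analysis propagates (Fröhlich–Spencer 1983) and fractional-moment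
methods bound (Aizenman–Molchanov), here under the interacting phase-quenched `SU(3)` measure. Finite-dimensional block
algebra (`Matrix.toBlock`, `Matrix.nonsing_inv_mul`, `Matrix.mul_nonsing_inv`). [folklore]
-/

noncomputable section

open scoped BigOperators
open Matrix Literature.MathematicalPhysics.QuantumLattice Literature.MathematicalPhysics.QuantumFieldTheory
  Literature.Probability.LatticeModels

namespace Summit.QuantumFields.QCD.Theorems.NestedDissectionSeaCoerciveSea

/-! ### Generic block algebra: the complement part of `M⁻¹ r` for a complement-supported `r` -/

section Generic

variable {m : Type*} [Fintype m] [DecidableEq m] (M : Matrix m m ℂ) (pr : m → Prop) [DecidablePred pr]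

/-- For a source `r` supported OFF the block `pr`, the complement part of `M⁻¹ r` is the complement-compressed inverse
applied to the complement part of `r`: `(M⁻¹ r)_q = ((M⁻¹)_qq) r_q`. [folklore] -/
theorem inv_mulVec_apply_neg_of_supported (r : m → ℂ) (hr : ∀ a : {a // pr a}, r a = 0) (b : {a // ¬ pr a}) :
    (M⁻¹ *ᵥ r) b = (M⁻¹.toBlock (fun a => ¬ pr a) (fun a => ¬ pr a) *ᵥ fun c => r c) b := by
  simp only [Matrix.mulVec, dotProduct, Matrix.toBlock_apply]
  rw [← Fintype.sum_subtype_add_sum_subtype pr (fun a => M⁻¹ b a * r a)]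
  have h0 : ∑ a : {a // pr a}, M⁻¹ b a * r a = 0 :=
    Finset.sum_eq_zero fun a _ => by rw [hr a, mul_zero]
  rw [h0, zero_add]

/-- For an invertible `M` and a vector `w` HARMONIC on the block `pr` (`(M w)_p = 0`), the complement part of `w` is the
complement-compressed inverse applied to the complement part of the residual: `w_q = ((M⁻¹)_qq) (M w)_q`. [folklore] -/
theorem apply_neg_eq_compressedInv_mulVec (hM : IsUnit M.det) (w : m → ℂ)
    (hharm : ∀ a : {a // pr a}, (M *ᵥ w) a = 0) (b : {a // ¬ pr a}) :
    w b = (M⁻¹.toBlock (fun a => ¬ pr a) (fun a => ¬ pr a) *ᵥ fun c => (M *ᵥ w) c) b := by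
  have hw : (M⁻¹ *ᵥ (M *ᵥ w)) b = w b := by
    rw [Matrix.mulVec_mulVec, Matrix.nonsing_inv_mul _ hM, Matrix.one_mulVec]
  rw [← hw]
  exact inv_mulVec_apply_neg_of_supported M pr (M *ᵥ w) hharm b

end Generic

/-! ### The crux's separator event is a large value of the separator-compressed cell propagator -/

/-- **`HasSingularSeparator` ↔ `‖(D_c⁻¹)_ΣΣ‖ > 1/τ`** (registered stub `hasSingularSeparator_iff_compressedInverse` of
crux stmt-QuantumFields-13901). For the Dirichlet Wilson cell `D_c(μ) = wilsonCell U μ 0 s` of the corner-`0` box `s` of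
any `SU(3)` field, IF the cell is invertible at the bare mass `μ`, then the crux's separator event at level `τ` holds iff
the inverse cell matrix compressed to the internal separator `Σ = box ∖ children interiors`,
`(D_c⁻¹)_ΣΣ = (D_c⁻¹).toBlock (¬ childrenInterior) (¬ childrenInterior)`, has a non-zero separator vector `v` with
`Σ_q ‖v_q‖² < τ² Σ_q ‖((D_c⁻¹)_ΣΣ v)_q‖²`. No hypothesis on the children block. [folklore] -/
theorem hasSingularSeparator_iff_compressedInverse :
    ∀ (N : ℕ) [NeZero N] (U : GaugeConfig 4 N (Matrix.specialUnitaryGroup (Fin 3) ℂ)) (μ : ℝ) (s : Fin 4 → ℕ)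
      (τ : ℝ), IsUnit (wilsonCell U μ 0 s).det →
      (HasSingularSeparator U μ s τ ↔
        ∃ v : {p : {p // wilsonBox (0 : TorusSite 4 N) s p} // ¬ childrenInterior s p} → ℂ, v ≠ 0 ∧
          ∑ q, ‖v q‖ ^ 2 < τ ^ 2 * ∑ q, ‖((wilsonCell U μ 0 s)⁻¹.toBlock (fun p => ¬ childrenInterior s p)
            (fun p => ¬ childrenInterior s p)).mulVec v q‖ ^ 2) := by
  intro N _ U μ s τ hM
  constructor
  · rintro ⟨w, ⟨p₀, hp₀, hw₀⟩, hharm, hres⟩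
    have hharm' : ∀ a : {p : {p // wilsonBox (0 : TorusSite 4 N) s p} // childrenInterior s p},
        (wilsonCell U μ 0 s *ᵥ w) a = 0 := fun a => hharm a a.2
    -- the complement part of `w` is the compressed inverse applied to the separator residual
    have hwq : ∀ q : {p : {p // wilsonBox (0 : TorusSite 4 N) s p} // ¬ childrenInterior s p},
        w q = ((wilsonCell U μ 0 s)⁻¹.toBlock (fun p => ¬ childrenInterior s p) (fun p => ¬ childrenInterior s p) *ᵥ
          fun c => (wilsonCell U μ 0 s *ᵥ w) c) q :=
      fun q => apply_neg_eq_compressedInv_mulVec (wilsonCell U μ 0 s) (childrenInterior s) hM w hharm' q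
    refine ⟨fun q => (wilsonCell U μ 0 s *ᵥ w) q, fun hv => hw₀ ?_, ?_⟩
    · -- if the separator residual vanished, `w|_Σ = (D_c⁻¹)_ΣΣ 0 = 0`
      rw [hwq ⟨p₀, hp₀⟩, hv, Matrix.mulVec_zero, Pi.zero_apply]
    · rw [sum_ite_eq_sum_subtype_neg (childrenInterior s) (fun p => ‖(wilsonCell U μ 0 s *ᵥ w) p‖ ^ 2),
        sum_ite_eq_sum_subtype_neg (childrenInterior s) (fun p => ‖w p‖ ^ 2)] at hres
      have hsum : ∑ q : {p : {p // wilsonBox (0 : TorusSite 4 N) s p} // ¬ childrenInterior s p}, ‖w q‖ ^ 2 =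
          ∑ q, ‖((wilsonCell U μ 0 s)⁻¹.toBlock (fun p => ¬ childrenInterior s p) (fun p => ¬ childrenInterior s p) *ᵥ
            fun c => (wilsonCell U μ 0 s *ᵥ w) c) q‖ ^ 2 :=
        Finset.sum_congr rfl fun q _ => by rw [← hwq q]
      rw [hsum] at hres
      exact hres
  · rintro ⟨v, hv0, hres⟩
    -- the zero extension `r` of `v` and the candidate `w = D_c⁻¹ r`
    let r : {p // wilsonBox (0 : TorusSite 4 N) s p} → ℂ := fun p => if h : childrenInterior s p then 0 else v ⟨p, h⟩
    have hr_pos : ∀ a : {p : {p // wilsonBox (0 : TorusSite 4 N) s p} // childrenInterior s p}, r a = 0 :=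
      fun a => dif_pos a.2
    have hr_neg : ∀ q : {p : {p // wilsonBox (0 : TorusSite 4 N) s p} // ¬ childrenInterior s p}, r q = v q :=
      fun q => by simp only [r, dif_neg q.2]
    have hMw : wilsonCell U μ 0 s *ᵥ ((wilsonCell U μ 0 s)⁻¹ *ᵥ r) = r := by
      rw [Matrix.mulVec_mulVec, Matrix.mul_nonsing_inv _ hM, Matrix.one_mulVec]
    have hwq : ∀ q : {p : {p // wilsonBox (0 : TorusSite 4 N) s p} // ¬ childrenInterior s p},
        ((wilsonCell U μ 0 s)⁻¹ *ᵥ r) q =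
          ((wilsonCell U μ 0 s)⁻¹.toBlock (fun p => ¬ childrenInterior s p) (fun p => ¬ childrenInterior s p) *ᵥ v) q := by
      intro q
      rw [inv_mulVec_apply_neg_of_supported (wilsonCell U μ 0 s) (childrenInterior s) r hr_pos q]
      congr 1
      funext c
      exact hr_neg c
    have hvpos : 0 < ∑ q, ‖v q‖ ^ 2 := by
      obtain ⟨q₀, hq₀⟩ : ∃ q, v q ≠ 0 := by
        by_contra h
        push Not at h
        exact hv0 (funext h)
      have h1 : 0 < ‖v q₀‖ ^ 2 := pow_pos (norm_pos_iff.mpr hq₀) 2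
      exact lt_of_lt_of_le h1
        (Finset.single_le_sum (f := fun q => ‖v q‖ ^ 2) (fun q _ => by positivity) (Finset.mem_univ q₀))
    refine ⟨(wilsonCell U μ 0 s)⁻¹ *ᵥ r, ?_, fun p hp => ?_, ?_⟩
    · -- non-zero on the separator: otherwise `(D_c⁻¹)_ΣΣ v = 0` and `0 < ‖v‖² < τ² · 0`
      by_contra h
      push Not at h
      have h0 : ∑ q, ‖((wilsonCell U μ 0 s)⁻¹.toBlock (fun p => ¬ childrenInterior s p)
          (fun p => ¬ childrenInterior s p) *ᵥ v) q‖ ^ 2 = 0 :=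
        Finset.sum_eq_zero fun q _ => by rw [← hwq q, h q q.2, norm_zero, zero_pow two_ne_zero]
      rw [h0, mul_zero] at hres
      exact absurd hres (not_lt.mpr hvpos.le)
    · -- harmonic on the children interiors
      rw [hMw]
      exact hr_pos ⟨p, hp⟩
    · -- residual and separator mass
      rw [sum_ite_eq_sum_subtype_neg (childrenInterior s) (fun p => ‖(wilsonCell U μ 0 s *ᵥ ((wilsonCell U μ 0 s)⁻¹ *ᵥ r)) p‖ ^ 2),
        sum_ite_eq_sum_subtype_neg (childrenInterior s) (fun p => ‖((wilsonCell U μ 0 s)⁻¹ *ᵥ r) p‖ ^ 2)]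
      simp only [hMw, hr_neg, hwq]
      exact hres

/-- **Hypothesis-free consequence** (the form the Wegner-type reading of clause (i) uses): a `τ`-singular separator forces
EITHER a zero mode of the cell at that very bare mass (`det D_c(μ) = 0`, a finite set of masses for each field) OR a large
value of the separator-compressed cell propagator, `∃ v ≠ 0 on Σ, ‖v‖² < τ² ‖(D_c⁻¹)_ΣΣ v‖²`. [folklore] -/
theorem hasSingularSeparator_imp_det_eq_zero_or_compressedInverse
    {N : ℕ} [NeZero N] (U : GaugeConfig 4 N (Matrix.specialUnitaryGroup (Fin 3) ℂ)) (μ : ℝ) (s : Fin 4 → ℕ) (τ : ℝ)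
    (h : HasSingularSeparator U μ s τ) :
    (wilsonCell U μ 0 s).det = 0 ∨
      ∃ v : {p : {p // wilsonBox (0 : TorusSite 4 N) s p} // ¬ childrenInterior s p} → ℂ, v ≠ 0 ∧
        ∑ q, ‖v q‖ ^ 2 < τ ^ 2 * ∑ q, ‖((wilsonCell U μ 0 s)⁻¹.toBlock (fun p => ¬ childrenInterior s p)
          (fun p => ¬ childrenInterior s p)).mulVec v q‖ ^ 2 := by
  by_cases hdet : (wilsonCell U μ 0 s).det = 0
  · exact Or.inl hdet
  · exact Or.inr ((hasSingularSeparator_iff_compressedInverse N U μ s τ (isUnit_iff_ne_zero.mpr hdet)).mp h)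

/-- **Converse off the crossings**: an invertible cell with a large separator-compressed propagator has a `τ`-singular
separator. [folklore] -/
theorem hasSingularSeparator_of_compressedInverse
    {N : ℕ} [NeZero N] (U : GaugeConfig 4 N (Matrix.specialUnitaryGroup (Fin 3) ℂ)) (μ : ℝ) (s : Fin 4 → ℕ) (τ : ℝ)
    (hdet : (wilsonCell U μ 0 s).det ≠ 0)
    (h : ∃ v : {p : {p // wilsonBox (0 : TorusSite 4 N) s p} // ¬ childrenInterior s p} → ℂ, v ≠ 0 ∧
        ∑ q, ‖v q‖ ^ 2 < τ ^ 2 * ∑ q, ‖((wilsonCell U μ 0 s)⁻¹.toBlock (fun p => ¬ childrenInterior s p)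
          (fun p => ¬ childrenInterior s p)).mulVec v q‖ ^ 2) :
    HasSingularSeparator U μ s τ :=
  (hasSingularSeparator_iff_compressedInverse N U μ s τ (isUnit_iff_ne_zero.mpr hdet)).mpr h

end Summit.QuantumFields.QCD.Theorems.NestedDissectionSeaCoerciveSea

end
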